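import Mathlib
import Literature.Combinatorics.Additive.TripleProductProperty
import Summits.MatrixMultiplication.MatrixMultiplication.Theses.SnSubsetDichotomy

/-!
# `SnSubsetDichotomy.UmvirateDescent` — descent bookkeeping (item stmt-MatrixMultiplication-8308)

The support statement `UmvirateDescent` of route `SnSubsetDichotomy` (card E2 of the
global/junta dichotomy; the step "peel a part of a Young subgroup" in the proof of
Blasiak–Church–Cohn–Grochow–Umans 2017, Thm. 4.2, stated for arbitrary subsets): for `t ≤ n`,
injective `t`-tuples `I, J, P` (sources) and `L` (common target) in `Fin n`, and a triple
`S, T, U ⊆ S_n` with the triple product property, there is a triple `S', T', U' ⊆ S_{n-t}` with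
the triple product property and
`|S'| = |{σ ∈ S : σ ∘ I = L}|`, `|T'| = |{τ ∈ T : τ ∘ J = L}|`, `|U'| = |{υ ∈ U : υ ∘ P = L}|`.

Proof (folklore bookkeeping).
* The three filtered sets are subsets of `S, T, U`, so they have the triple product property
  (`TripleProductProperty.mono`).
* Pick permutations `a, b, c ∈ S_n` with `a ∘ L = I`, `b ∘ L = J`, `c ∘ L = P`
  (`Equiv.Perm.exists_extending_pair`).  If `σ ∘ I = L` then `σ a` fixes `range L` pointwise;
  likewise `τ b`, `υ c`.
* The pointwise stabiliser of `range L` is the image of the injective group homomorphism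
  `ψ : Perm (Fin (n - t)) →* Perm (Fin n)`, `ψ = ofSubtype ∘ permCongrHom e` for a bijection
  `e : Fin (n - t) ≃ {x // x ∉ range L}` (`Fintype.card_subtype_compl`,
  `Set.card_range_of_injective`; surjectivity onto the stabiliser is
  `Equiv.Perm.subtypeEquivSubtypePerm`).
* Put `S' := {ρ : ψ ρ · a⁻¹ ∈ S₀}`, `T' := {ρ : ψ ρ · b⁻¹ ∈ T₀}`, `U' := {ρ : ψ ρ · c⁻¹ ∈ U₀}`.
  Since `(x z⁻¹)(y z⁻¹)⁻¹ = x y⁻¹`, the right quotients of `S'` map under `ψ` to right quotients of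
  `S₀` (and similarly for `T', U'`), so the triple product property pulls back along the injective
  homomorphism `ψ`; and `ρ ↦ ψ ρ · a⁻¹` is a bijection `S' → S₀` because every `σ a`, `σ ∈ S₀`, lies
  in the stabiliser `= range ψ`.

No named facts are used; the result is unconditional.
-/

namespace Summit.MatrixMultiplication.MatrixMultiplication.Theorems

open Literature.Combinatorics.Additive
open Summit.MatrixMultiplication.MatrixMultiplication.Theses.SnSubsetDichotomy

-- `Summit.<Summit>.<Problem>` is the tree's mandated summit-side namespace (CONVENTIONS §2); for
-- this single-conjunct summit the two coincide, so each declaration silences `dupNamespace`.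

set_option linter.dupNamespace false in -- deliberate `Summit.<S>.<P>` duplicate
/-- **The triple product property pulls back along an injective homomorphism followed by right
translations.**  If `ψ : G →* H` is injective, `S, T, U ⊆ H` have the triple product property, and
`S', T', U' ⊆ G` satisfy `ψ(S') a⁻¹ ⊆ S`, `ψ(T') b⁻¹ ⊆ T`, `ψ(U') c⁻¹ ⊆ U`, then `S', T', U'` have
the triple product property (right quotients are invariant under right translation:
`(x z⁻¹)(y z⁻¹)⁻¹ = x y⁻¹`). [folklore] -/
theorem tripleProductProperty_pullback_mul_inv {G H : Type*} [Group G] [Group H] (ψ : G →* H)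
    (hψ : Function.Injective ψ) (a b c : H) {S T U : Finset H}
    (h : TripleProductProperty S T U) {S' T' U' : Finset G} (hS : ∀ ρ ∈ S', ψ ρ * a⁻¹ ∈ S)
    (hT : ∀ ρ ∈ T', ψ ρ * b⁻¹ ∈ T) (hU : ∀ ρ ∈ U', ψ ρ * c⁻¹ ∈ U) :
    TripleProductProperty S' T' U' := by
  intro s hs s' hs' t ht t' ht' u hu u' hu' he
  have aux : ∀ x y z : H, x * z⁻¹ * (y * z⁻¹)⁻¹ = x * y⁻¹ := by
    intro x y z
    group
  have himg : ψ s * (ψ s')⁻¹ * (ψ t * (ψ t')⁻¹) * (ψ u * (ψ u')⁻¹) = 1 := by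
    simpa only [map_mul, map_inv, map_one] using congrArg ψ he
  have key : ψ s * a⁻¹ * (ψ s' * a⁻¹)⁻¹ * (ψ t * b⁻¹ * (ψ t' * b⁻¹)⁻¹) *
      (ψ u * c⁻¹ * (ψ u' * c⁻¹)⁻¹) = 1 := by
    rw [aux, aux, aux]
    exact himg
  obtain ⟨h1, h2, h3⟩ := h _ (hS s hs) _ (hS s' hs') _ (hT t ht) _ (hT t' ht') _ (hU u hu) _
    (hU u' hu') key
  exact ⟨hψ (mul_right_cancel h1), hψ (mul_right_cancel h2), hψ (mul_right_cancel h3)⟩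

set_option linter.dupNamespace false in -- deliberate `Summit.<S>.<P>` duplicate
/-- **Counting the pull-back.**  If `ψ : G →* H` is injective (`G` finite) and every `σ a`,
`σ ∈ S`, lies in the range of `ψ`, then `ρ ↦ ψ ρ · a⁻¹` is a bijection from
`{ρ ∈ G : ψ ρ · a⁻¹ ∈ S}` onto `S`; in particular the two sets have the same cardinality.
[folklore] -/
theorem card_filter_map_mul_inv_mem {G H : Type*} [Group G] [Group H] [Fintype G]
    (ψ : G →* H) (hψ : Function.Injective ψ) (a : H) (S : Finset H)
    (hS : ∀ σ ∈ S, σ * a ∈ Set.range ψ) [DecidablePred fun ρ : G => ψ ρ * a⁻¹ ∈ S] :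
    (Finset.univ.filter fun ρ : G => ψ ρ * a⁻¹ ∈ S).card = S.card := by
  refine Finset.card_bij (fun ρ _ => ψ ρ * a⁻¹) (fun ρ hρ => (Finset.mem_filter.mp hρ).2)
    (fun ρ₁ _ ρ₂ _ h => hψ (mul_right_cancel h)) (fun σ hσ => ?_)
  obtain ⟨ρ, hρ⟩ := hS σ hσ
  refine ⟨ρ, Finset.mem_filter.mpr ⟨Finset.mem_univ _, ?_⟩, ?_⟩
  · rw [hρ, mul_inv_cancel_right]
    exact hσ
  · rw [hρ, mul_inv_cancel_right]

set_option linter.dupNamespace false in -- deliberate `Summit.<S>.<P>` duplicate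
/-- **Descent along an injective homomorphism, abstract form.**  Let `ψ : G →* H` be injective with
`G` finite, `a, b, c ∈ H`, and `S, T, U ⊆ H` a triple with the triple product property such that
`S a`, `T b`, `U c` lie in the range of `ψ`.  Then there are `S', T', U' ⊆ G` with the triple
product property and `|S'| = |S|`, `|T'| = |T|`, `|U'| = |U|` (namely the pull-backs of
`S a, T b, U c`). [folklore] -/
theorem exists_tripleProductProperty_pullback {G H : Type*} [Group G] [Group H] [Fintype G]
    (ψ : G →* H) (hψ : Function.Injective ψ) (a b c : H) {S T U : Finset H}
    (h : TripleProductProperty S T U) (hS : ∀ σ ∈ S, σ * a ∈ Set.range ψ)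
    (hT : ∀ τ ∈ T, τ * b ∈ Set.range ψ) (hU : ∀ υ ∈ U, υ * c ∈ Set.range ψ) :
    ∃ S' T' U' : Finset G, TripleProductProperty S' T' U' ∧
      S'.card = S.card ∧ T'.card = T.card ∧ U'.card = U.card := by
  classical
  refine ⟨Finset.univ.filter fun ρ => ψ ρ * a⁻¹ ∈ S, Finset.univ.filter fun ρ => ψ ρ * b⁻¹ ∈ T,
    Finset.univ.filter fun ρ => ψ ρ * c⁻¹ ∈ U, ?_, card_filter_map_mul_inv_mem ψ hψ a S hS,
    card_filter_map_mul_inv_mem ψ hψ b T hT, card_filter_map_mul_inv_mem ψ hψ c U hU⟩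
  exact tripleProductProperty_pullback_mul_inv ψ hψ a b c h
    (fun ρ hρ => (Finset.mem_filter.mp hρ).2) (fun ρ hρ => (Finset.mem_filter.mp hρ).2)
    (fun ρ hρ => (Finset.mem_filter.mp hρ).2)

set_option linter.dupNamespace false in -- deliberate `Summit.<S>.<P>` duplicate
/-- **The pointwise stabiliser of `range L` in `S_n` is a copy of `S_{n-t}`.**  For an injective
`L : Fin t → Fin n` there is an injective homomorphism `ψ : Perm (Fin (n - t)) →* Perm (Fin n)`
whose range contains every permutation fixing `L k` for all `k` (it is `ofSubtype ∘ permCongrHom e`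
for a bijection `e : Fin (n - t) ≃ {x // x ∉ range L}`, which exists because
`|{x // x ∉ range L}| = n - t`). [folklore] -/
theorem exists_monoidHom_perm_range_stabilizer {n t : ℕ} (L : Fin t → Fin n)
    (hL : Function.Injective L) :
    ∃ ψ : Equiv.Perm (Fin (n - t)) →* Equiv.Perm (Fin n), Function.Injective ψ ∧
      ∀ π : Equiv.Perm (Fin n), (∀ k, π (L k) = L k) → π ∈ Set.range ψ := by
  classical
  have hcard : Fintype.card {x : Fin n // x ∉ Set.range L} = n - t := by
    rw [Fintype.card_subtype_compl, Fintype.card_fin, Set.card_range_of_injective hL,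
      Fintype.card_fin]
  let e : Fin (n - t) ≃ {x : Fin n // x ∉ Set.range L} := (Fintype.equivFinOfCardEq hcard).symm
  refine ⟨Equiv.Perm.ofSubtype.comp e.permCongrHom.toMonoidHom,
    Equiv.Perm.ofSubtype_injective.comp e.permCongrHom.injective, fun π hπ => ?_⟩
  have hπ' : ∀ x : Fin n, ¬(x ∉ Set.range L) → π x = x := by
    intro x hx
    obtain ⟨k, rfl⟩ := not_not.mp hx
    exact hπ k
  refine ⟨e.permCongr.symm ((Equiv.Perm.subtypeEquivSubtypePerm _).symm ⟨π, hπ'⟩), ?_⟩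
  have key := congrArg Subtype.val
    ((Equiv.Perm.subtypeEquivSubtypePerm fun x : Fin n => x ∉ Set.range L).apply_symm_apply
      ⟨π, hπ'⟩)
  rw [MonoidHom.comp_apply, MulEquiv.coe_toMonoidHom, Equiv.permCongrHom_coe,
    Equiv.apply_symm_apply]
  exact key

set_option linter.dupNamespace false in -- deliberate `Summit.<S>.<P>` duplicate
/-- **`UmvirateDescent` (item stmt-MatrixMultiplication-8308, route `SnSubsetDichotomy`).**
For `t ≤ n`, injective `I, J, P, L : Fin t → Fin n` and a triple `S, T, U ⊆ S_n` with the triple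
product property there are `S', T', U' ⊆ S_{n-t}` with the triple product property and
`|S'| = |{σ ∈ S : ∀ k, σ (I k) = L k}|`, `|T'| = |{τ ∈ T : ∀ k, τ (J k) = L k}|`,
`|U'| = |{υ ∈ U : ∀ k, υ (P k) = L k}|`: filter (heredity of the property), right-translate by
`a, b, c` with `a ∘ L = I`, `b ∘ L = J`, `c ∘ L = P` into the pointwise stabiliser of `range L`,
and pull back along `S_{n-t} ≅ Stab(range L) ≤ S_n`. (The hypothesis `t ≤ n` is not needed: for
`t > n` there is no injective `L`.) [folklore; cf. BlasiakChurchCohnGrochowUmans2017, proof of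
Thm. 4.2] -/
theorem umvirateDescent_proof : UmvirateDescent := by
  unfold UmvirateDescent
  intro n t _ht I J P L hI hJ hP hL S T U hTPP
  obtain ⟨a, ha⟩ := Equiv.Perm.exists_extending_pair L I hL hI
  obtain ⟨b, hb⟩ := Equiv.Perm.exists_extending_pair L J hL hJ
  obtain ⟨c, hc⟩ := Equiv.Perm.exists_extending_pair L P hL hP
  obtain ⟨ψ, hψ, hrange⟩ := exists_monoidHom_perm_range_stabilizer L hL
  refine exists_tripleProductProperty_pullback ψ hψ a b c
    (hTPP.mono (Finset.filter_subset _ _) (Finset.filter_subset _ _) (Finset.filter_subset _ _))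
    (fun σ hσ => hrange _ fun k => ?_) (fun τ hτ => hrange _ fun k => ?_)
    (fun υ hυ => hrange _ fun k => ?_)
  · rw [Equiv.Perm.mul_apply, ha, (Finset.mem_filter.mp hσ).2 k]
  · rw [Equiv.Perm.mul_apply, hb, (Finset.mem_filter.mp hτ).2 k]
  · rw [Equiv.Perm.mul_apply, hc, (Finset.mem_filter.mp hυ).2 k]

end Summit.MatrixMultiplication.MatrixMultiplication.Theorems
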